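import Mathlib
import Summits.Ventures.HodgeRepro.Tier4.Target

/-!
# Tier4/Common/TargetData — the frozen target `P_T4` as «∀ datum, conclusion»: the datum bundled, the conclusion named

Blind re-derivation cell `pub-hodge-repro`, Tier 4 (README §9–§10), seat t4-typer-1 (gen 0).  Target tree path
`lean/Summits/Ventures/HodgeRepro/Tier4/Common/TargetData.lean`.  Imports the FROZEN `Tier4/Target.lean` (lead,
p658314, sha256 7e1ddb58699909ce911c9fbd810407027caa7a90f754dc3587f9e2627ee22896 · 263 l.; «T4 TARGET FROZEN»
S11958) and NOTHING else of Tier 4; it does not restate, weaken or strengthen `P_T4` — it names its parts.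

WHAT IS TYPED.  `P_T4` is a universally quantified sentence over twenty-odd objects and hypotheses followed by an
existential conclusion.  `TargetData F E` bundles EXACTLY the universally quantified objects and hypotheses of
`P_T4` beyond the two Galois CM fields `F`, `E` and their typeclass hypotheses (which stay parameters): the
rank-four face `T` of `F`, `[E⁺:ℚ] ≥ 2`, the embedding `ι`, the anisotropic `c`-hermitian `H` of signature `(2,1)`
at `τ₀` and definite elsewhere, the Sylvester matrix `C`, the congruence subgroup `Γ`, the embedding `s`, the
`𝒪_F`-stable lattices `Λ_i`, the Albanese lifts `a_i`, and the labelling `i₁ ≠ i₂`, `i₃ ≠ i₄` with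
`s ∈ T_{i₁} ∩ T_{i₂}`, `s̄ ∈ T_{i₃} ∩ T_{i₄}` — in the order of `P_T4`; `TargetData.conclusion d` is EXACTLY the
existential conclusion of `P_T4` for the datum `d` («∃ Γ′ ≤ Γ congruence, ∃ four Hecke elements of level Γ′, ∃ a
fundamental domain `D`, `∫_D jac_s · conj jac_{s̄} ≠ 0`»).
`P_T4_iff_forall : P_T4 ↔ ∀ F E […] (d : TargetData F E), d.conclusion` is proved by unfolding — so a line proves
`P_T4` by proving `d.conclusion` for an arbitrary datum `d` (`P_T4_of_forall`), and every lemma of every line can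
be stated over one `d`.  The shared sub-objects of the conclusion are named: `conjE E` (the conjugation `c` of `E`),
`d.act γ` (the ball action of `γ`), `d.lift h i` (the Hecke translate `T_h a_i`), `d.jacS h` / `d.jacSbar h` (the
coefficients of `f^*Ω_s` / `f^*Ω_{s̄}` on `dz₀ ∧ dz₁`), `d.pairing D h` (the integral), `d.IsLevel Γ′`,
`d.IsHeckeFor Γ′ h`, `d.IsDomain Γ′ D`, with `conclusion_iff` unfolding the conclusion to them and `conclusion_of`
assembling it from them.

Nothing here says anything about the status of the Hodge conjecture for CM abelian varieties, which is NOT proved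
(HC_CM is NOT proved by anyone in this repository).
-/

set_option autoImplicit false

noncomputable section

open Matrix MeasureTheory NumberField
open scoped ComplexConjugate ComplexOrder

namespace Summit.Ventures.HodgeRepro.Tier4

/-- The complex conjugation of the CM field `E` as a ring automorphism (the `c` of `P_T4`). -/
def conjE (E : Type) [Field E] [NumberField E] [IsCMField E] : E ≃+* E := (IsCMField.complexConj E).toRingEquiv

/-- **The datum of `P_T4`** for the Galois CM fields `F` (the face) and `E` (the hermitian space): the universally
quantified objects and hypotheses of the frozen target, in its order. -/
structure TargetData (F E : Type) [Field F] [NumberField F] [IsGalois ℚ F] [IsCMField F]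
    [Field E] [NumberField E] [IsGalois ℚ E] [IsCMField E] where
  /-- the four CM types of the face -/
  T : Fin 4 → Finset (F →+* ℂ)
  /-- `T` is a rank-four face -/
  hT : IsRankFourFace F T
  /-- `[E⁺ : ℚ] ≥ 2` -/
  hE : 2 ≤ Module.finrank ℚ (maximalRealSubfield E)
  /-- the embedding `ι : F → E` -/
  ι : F →+* E
  /-- the hermitian matrix `H` of `V = E³` -/
  H : Matrix (Fin 3) (Fin 3) E
  /-- `H` is `c`-hermitian -/
  hH : IsCHermitian (IsCMField.complexConj E).toRingEquiv H
  /-- `V` is anisotropic -/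
  hani : Anisotropic (IsCMField.complexConj E).toRingEquiv H
  /-- the distinguished embedding `τ₀ : E → ℂ` -/
  τ₀ : E →+* ℂ
  /-- `H` is definite at every embedding other than `τ₀, τ̄₀` -/
  hdef : ∀ τ : E →+* ℂ, τ ≠ τ₀ → τ ≠ conjEmb τ₀ → IsDefinite (H.map τ)
  /-- the Sylvester matrix `C` -/
  C : Matrix (Fin 3) (Fin 3) ℂ
  /-- `Cᴴ τ₀(H) C = ±J` -/
  hC : IsSylvester (H.map τ₀) C
  /-- the congruence subgroup `Γ` -/
  Γ : Set (Matrix (Fin 3) (Fin 3) E)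
  /-- `Γ` is a congruence subgroup of `U(H)` -/
  hΓ : IsCongruenceSubgroup (IsCMField.complexConj E).toRingEquiv H Γ
  /-- the embedding `s : F → ℂ` -/
  s : F →+* ℂ
  /-- the lattices `Λ_i ⊂ ℂ^{T_i}` -/
  Λ : ∀ i : Fin 4, Submodule ℤ (↥(T i) → ℂ)
  /-- the lattices are discrete -/
  discrete : ∀ i, DiscreteTopology (Λ i)
  /-- the lattices are full -/
  lattice : ∀ i, IsZLattice ℝ (Λ i)
  /-- the lattices are `𝒪_F`-stable -/
  hΛ : ∀ i, IsOFStable (T i) (Λ i)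
  /-- the Albanese lifts `a_i : ℂ² → ℂ^{T_i}` -/
  a : ∀ i : Fin 4, (Fin 2 → ℂ) → (↥(T i) → ℂ)
  /-- the `a_i` are Albanese lifts -/
  ha : ∀ i, IsAlbaneseLift (T i) (Λ i) τ₀ C Γ (a i)
  /-- the first corner containing `s` -/
  i₁ : Fin 4
  /-- the second corner containing `s` -/
  i₂ : Fin 4
  /-- the first corner containing `s̄` -/
  i₃ : Fin 4
  /-- the second corner containing `s̄` -/
  i₄ : Fin 4
  /-- `i₁ ≠ i₂` -/
  h12 : i₁ ≠ i₂
  /-- `i₃ ≠ i₄` -/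
  h34 : i₃ ≠ i₄
  /-- `s ∈ T_{i₁}` -/
  hs₁ : s ∈ T i₁
  /-- `s ∈ T_{i₂}` -/
  hs₂ : s ∈ T i₂
  /-- `s̄ ∈ T_{i₃}` -/
  hs₃ : conjEmb s ∈ T i₃
  /-- `s̄ ∈ T_{i₄}` -/
  hs₄ : conjEmb s ∈ T i₄

namespace TargetData

variable {F E : Type} [Field F] [NumberField F] [IsGalois ℚ F] [IsCMField F]
  [Field E] [NumberField E] [IsGalois ℚ E] [IsCMField E] (d : TargetData F E)

/-- The ball action of `γ` (a matrix over `E`) on `ℂ²`: `actM (C⁻¹ τ₀(γ) C)`. -/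
def act (γ : Matrix (Fin 3) (Fin 3) E) : (Fin 2 → ℂ) → (Fin 2 → ℂ) := actM (toBallMat d.τ₀ d.C γ)

/-- The Hecke translate `T_h a_i` of the `i`-th Albanese lift. -/
def lift (h : HeckeElement E) (i : Fin 4) : (Fin 2 → ℂ) → (↥(d.T i) → ℂ) := heckeTranslate d.τ₀ d.C h (d.a i)

/-- The coefficient `jac_s` of `f^*Ω_s = f^*ω_{i₁,s} ∧ f^*ω_{i₂,s}` on `dz₀ ∧ dz₁` for the translates `h`. -/
def jacS (h : Fin 4 → HeckeElement E) : (Fin 2 → ℂ) → ℂ :=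
  jacDet (comp (d.T d.i₁) d.s d.hs₁ (d.lift (h d.i₁) d.i₁)) (comp (d.T d.i₂) d.s d.hs₂ (d.lift (h d.i₂) d.i₂))

/-- The coefficient `jac_{s̄}` of `f^*Ω_{s̄} = f^*ω_{i₃,s̄} ∧ f^*ω_{i₄,s̄}` on `dz₀ ∧ dz₁` for the translates `h`. -/
def jacSbar (h : Fin 4 → HeckeElement E) : (Fin 2 → ℂ) → ℂ :=
  jacDet (comp (d.T d.i₃) (conjEmb d.s) d.hs₃ (d.lift (h d.i₃) d.i₃))
    (comp (d.T d.i₄) (conjEmb d.s) d.hs₄ (d.lift (h d.i₄) d.i₄))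

/-- The pairing `∫_D jac_s · conj jac_{s̄}` of the two `2`-forms over the fundamental domain `D`. -/
def pairing (D : Set (Fin 2 → ℂ)) (h : Fin 4 → HeckeElement E) : ℂ :=
  ∫ z in D, d.jacS h z * conj (d.jacSbar h z)

/-- `Γ′` is a congruence subgroup of `U(H)` contained in `Γ`. -/
def IsLevel (Γ' : Set (Matrix (Fin 3) (Fin 3) E)) : Prop := IsCongruenceSubgroup (conjE E) d.H Γ' ∧ Γ' ⊆ d.Γ

/-- The four Hecke elements are of level `Γ′`. -/
def IsHeckeFor (Γ' : Set (Matrix (Fin 3) (Fin 3) E)) (h : Fin 4 → HeckeElement E) : Prop :=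
  ∀ i, (h i).IsFor (conjE E) d.H Γ'

/-- `D` is a fundamental domain for the ball action of `Γ′`. -/
def IsDomain (Γ' : Set (Matrix (Fin 3) (Fin 3) E)) (D : Set (Fin 2 → ℂ)) : Prop :=
  IsFundamentalDomainFor (ballActions d.τ₀ d.C Γ') D

/-- **The conclusion of `P_T4` for the datum `d`**, verbatim: for some deeper level `Γ′ ≤ Γ`, some Hecke elements
of that level and some fundamental domain `D`, `∫_D jac_s · conj jac_{s̄} ≠ 0`. -/
def conclusion : Prop :=
  ∃ (Γ' : Set (Matrix (Fin 3) (Fin 3) E)),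
    IsCongruenceSubgroup (IsCMField.complexConj E).toRingEquiv d.H Γ' ∧ Γ' ⊆ d.Γ ∧
  ∃ (h : Fin 4 → HeckeElement E), (∀ i, (h i).IsFor (IsCMField.complexConj E).toRingEquiv d.H Γ') ∧
  ∃ (D : Set (Fin 2 → ℂ)), IsFundamentalDomainFor (ballActions d.τ₀ d.C Γ') D ∧
    ∫ z in D,
      jacDet (comp (d.T d.i₁) d.s d.hs₁ (heckeTranslate d.τ₀ d.C (h d.i₁) (d.a d.i₁)))
             (comp (d.T d.i₂) d.s d.hs₂ (heckeTranslate d.τ₀ d.C (h d.i₂) (d.a d.i₂))) z *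
      conj (jacDet (comp (d.T d.i₃) (conjEmb d.s) d.hs₃ (heckeTranslate d.τ₀ d.C (h d.i₃) (d.a d.i₃)))
                   (comp (d.T d.i₄) (conjEmb d.s) d.hs₄ (heckeTranslate d.τ₀ d.C (h d.i₄) (d.a d.i₄))) z) ≠ 0

/-- The conclusion in the named vocabulary: a level, Hecke elements of that level, a domain, a non-zero pairing. -/
theorem conclusion_iff :
    d.conclusion ↔ ∃ Γ' : Set (Matrix (Fin 3) (Fin 3) E), d.IsLevel Γ' ∧
      ∃ h : Fin 4 → HeckeElement E, d.IsHeckeFor Γ' h ∧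
        ∃ D : Set (Fin 2 → ℂ), d.IsDomain Γ' D ∧ d.pairing D h ≠ 0 := by
  unfold conclusion IsLevel IsHeckeFor IsDomain pairing jacS jacSbar lift conjE
  constructor
  · rintro ⟨Γ', h1, h2, h, h3, D, h4, h5⟩
    exact ⟨Γ', ⟨h1, h2⟩, h, h3, D, h4, h5⟩
  · rintro ⟨Γ', ⟨h1, h2⟩, h, h3, D, h4, h5⟩
    exact ⟨Γ', h1, h2, h, h3, D, h4, h5⟩

/-- A witness of the conclusion in the named vocabulary gives the conclusion. -/
theorem conclusion_of (Γ' : Set (Matrix (Fin 3) (Fin 3) E)) (hΓ' : d.IsLevel Γ')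
    (h : Fin 4 → HeckeElement E) (hh : d.IsHeckeFor Γ' h) (D : Set (Fin 2 → ℂ)) (hD : d.IsDomain Γ' D)
    (hne : d.pairing D h ≠ 0) : d.conclusion :=
  d.conclusion_iff.2 ⟨Γ', hΓ', h, hh, D, hD, hne⟩

end TargetData

/-- **`P_T4` is «for every datum, the conclusion»** — by unfolding; nothing is added or removed. -/
theorem P_T4_iff_forall : P_T4 ↔
    ∀ (F E : Type) [Field F] [NumberField F] [IsGalois ℚ F] [IsCMField F]
      [Field E] [NumberField E] [IsGalois ℚ E] [IsCMField E] (d : TargetData F E), d.conclusion := by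
  constructor
  · intro h F E _ _ _ _ _ _ _ _ d
    haveI := d.discrete
    haveI := d.lattice
    exact h F d.T d.hT E d.hE d.ι d.H d.hH d.hani d.τ₀ d.hdef d.C d.hC d.Γ d.hΓ d.s d.Λ d.hΛ d.a d.ha
      d.i₁ d.i₂ d.i₃ d.i₄ d.h12 d.h34 d.hs₁ d.hs₂ d.hs₃ d.hs₄
  · intro h F _ _ _ _ T hT E _ _ _ _ hE ι H hH hani τ₀ hdef C hC Γ hΓ s Λ hdisc hlat hΛ a ha i₁ i₂ i₃ i₄ h12 h34
      hs₁ hs₂ hs₃ hs₄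
    exact h F E ⟨T, hT, hE, ι, H, hH, hani, τ₀, hdef, C, hC, Γ, hΓ, s, Λ, hdisc, hlat, hΛ, a, ha, i₁, i₂, i₃, i₄,
      h12, h34, hs₁, hs₂, hs₃, hs₄⟩

/-- To prove `P_T4` it suffices to prove the conclusion for an arbitrary datum over arbitrary Galois CM fields. -/
theorem P_T4_of_forall
    (h : ∀ (F E : Type) [Field F] [NumberField F] [IsGalois ℚ F] [IsCMField F]
      [Field E] [NumberField E] [IsGalois ℚ E] [IsCMField E] (d : TargetData F E), d.conclusion) : P_T4 :=
  P_T4_iff_forall.2 h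

end Summit.Ventures.HodgeRepro.Tier4
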